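import Mathlib
import HarnessLib
import Summits.Schanuel.Schanuel.Theses.CoprimeExpPolynomials
import Literature.Barriers.KontsevichZagierPeriods.GrothendieckPeriodConjectureDependenceProofs
import Literature.Barriers.Schanuel.AxSchanuelFunctionalNotNumericalNarrow

/-!
# Birth skeleton (BC3) — crux `CoprimeExpPolynomials.DilationRigidity` (stmt-Schanuel-3765)

Route `route-Schanuel-CoprimeExpPolynomials`, crux of rank 4 (the `n = 2` layer of rank-one Schanuel):

  `DilationRigidity := ∀ (y β : ℂ), Transcendental ℚ y → ¬ AlgebraicIndependent ℚ ![y, e^y] →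
      IsAlgebraic ℚ β → β ∉ range ((↑) : ℚ → ℂ) → AlgebraicIndependent ℚ ![β·y, e^{β·y}]`

— the countable set `𝒮 = {y : (y, e^y) algebraically dependent over ℚ}` of simply-exponential-algebraic
numbers meets none of its irrational algebraic dilates off `ℚ̄`.

This file is the route-level BIRTH CERTIFICATE skeleton of the crux (LENSES-v3 §2 BC3; registrar seat
`planner-skel-stmt-Schanuel-3765-0`, 2026-08-17, route re-audit bin REPAIRABLE): TWO NAMED STUBS and a
kernel-checked composition concluding the crux BY NAME. `sorry` occurs ONLY in the two `stub_*` theorems.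

## The seam: GEL'FOND'S CONJECTURE (used twice, through the involution `β ↦ β⁻¹`) × THE WILD CELL

For `y ∈ 𝒮 ∖ ℚ̄` and `β ∈ ℚ̄ ∖ ℚ` a failure of the crux is a field `K = ℚ(y, e^y, e^{βy})` of transcendence
degree exactly `1`. Sort the failures by which of the two exponentials is algebraic:

* `e^y ∈ ℚ̄` (the LOG CELL `y = log α`): the crux there is Gel'fond's conjecture — `log α` and `α^β` are
  algebraically independent — i.e. the route's own rank-5 crux `LogAlphaAlphaBetaAlgIndep`
  (stmt-Schanuel-0084, shared with route AlgIndepMethod), read in dilation coordinates through the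
  scale-invariance of algebraic independence (`ℚ`-independence of `![β·l, w]` iff of `![l, w]` for
  `β ∈ ℚ̄ˣ`; tree lemma `Literature.Barriers.KontsevichZagierPeriods.algebraicIndependent_pair_mul_iff`).
* `e^{βy} ∈ ℚ̄` (the INVERSE LOG CELL): put `y' := βy = log γ`, `β' := β⁻¹ ∈ ℚ̄ ∖ ℚ`; Gel'fond's
  conjecture at `(γ, β')` says `![βy, e^{y}]` is independent, hence (scale-invariance) so is `![y, e^y]` —
  contradicting `y ∈ 𝒮`. So Gel'fond's conjecture alone proves: **for `y ∈ 𝒮 ∖ ℚ̄` and `β ∈ ℚ̄ ∖ ℚ`,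
  `e^{βy}` is transcendental** (`transcendental_exp_dilate_of_gelfond`, sorry-free). This FOLD is the one
  non-obvious step of the seam: the sub-case "`e^{βy}` algebraic" is NOT a new open problem.
* `y, e^y, e^{βy}` ALL transcendental (the WILD CELL: fixed points of `exp`, `Ω`-type numbers, zeros of a
  `p(z, e^z)` irreducible of positive degree in both variables, …): no classical name, no proved instance;
  it is the second stub, verbatim the crux restricted to this cell.

Hence `DilationRigidity ⟸ LogAlphaAlphaBetaAlgIndep ∧ WildCell` (`DilationRigidity_of`, a `by_cases` on
`IsAlgebraic ℚ (e^y)` feeding the fold into the wild cell). Conversely the crux gives both stubs back: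
`WildCell` by restriction (`wildCell_of_dilationRigidity`, sorry-free, below) and `LogAlphaAlphaBetaAlgIndep`
by Hermite–Lindemann + scale-invariance — that converse is exactly the route's support item
`LogCellOfDilation` (stmt-Schanuel-3772, provable now, left to provers: this seat proves nothing beyond the
assembly). So the cut is EXACT: `crux ⟺ stub₁ ∧ stub₂` given Hermite–Lindemann (in tree).

* `stub_gelfondConjecture : …CoprimeExpPolynomials.LogAlphaAlphaBetaAlgIndep` — Gel'fond's conjecture
  (Gelfond1934; Waldschmidt2004 §3.1; open even for `(log 2, 2^√2)`), stated BY NAME as the route item it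
  is, so that a proof of stmt-Schanuel-0084 closes this stub verbatim. Why it might fail / size: it is an
  open problem at the `d = 2, ℓ = 1` grid point below every algebraic-independence criterion
  (NesterenkoPhilippon2001 Ch. 14 Thm 2.9 needs `dℓ > d + ℓ`); proved cells: `α` a root of unity and `β`
  imaginary quadratic (Nesterenko 1996 — `cmDilate_gelfond_instance` below is the `(−1, −i)` instance,
  sorry-free from the tree's `nesterenko_holds`).
* `stub_wildCell` — the crux on the wild cell (all three of `y, e^y, e^{βy}` transcendental). Why it might
  fail: it contains the fixed points of `exp` dilated by `√2` and by `i`, about which nothing is known; a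
  single `y` with `p(y, e^y) = 0`, `q(βy, e^{βy}) = 0` (`p, q` irreducible, positive degree in each
  variable) refutes rank-one Schanuel and hence Schanuel. Size: crux-hard (open).
* `DilationRigidity_of : LogAlphaAlphaBetaAlgIndep → Sig.stub_wildCell → DilationRigidity` — SORRY-FREE
  composition (axioms `propext`, `Classical.choice`, `Quot.sound`).
* `DilationRigidity_proof : DilationRigidity` — the skeleton in its final shape (the crux BY NAME from the
  two registered stubs; depends on `sorryAx` through the stubs only).

## Calibration (BC5, sorry-free): the CM dilate `(y, β) = (πi, −i)`

`cmDilate_conclusion : AlgebraicIndependent ℚ ![(−i)·(πi), e^{(−i)(πi)}]` (`= ![π, e^π]`, Nesterenko 1996,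
tree `Literature.Barriers.Schanuel.algebraicIndependent_pi_cexp_pi`), together with the four hypotheses
of the crux at that point (`cmDilate_hypotheses`: `πi` transcendental, `(πi, e^{πi} = −1)` dependent, `−i`
algebraic irrational) and the matching instance of stub 1 at `(α, β, l) = (−1, −i, πi)`
(`cmDilate_gelfond_instance : AlgebraicIndependent ℚ ![πi, e^{π}]`): the typing computes, the crux and
stub 1 are inhabited-in-kind, and the proved instance sits in the LOG CELL, as the seam predicts (every
proved dilate known is a CM dilate of `πi`).

## Disproof used / negatives

No `Cruxes/DilationRigidity/Disproof.lean` exists (`ledger crux ls stmt-Schanuel-3765`: no workfiles, no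
crux ideas, no lines — 2026-08-17); no `_false_without_` theorem, no landed
`Theorems/DilationRigidity/Negative/*`. The refuter route-review (aa031e05, item note 2026-08-15) recorded
the CONJUGATION family `β = ȳ/y` on rays with `e^{2i·arg y} ∈ ℚ̄ ∖ {±1}` as the crux's cheapest potential
witness and checked it is excluded by SC; in this skeleton that family lies in the wild cell unless
`e^y ∈ ℚ̄` (impossible on such rays by Gel'fond–Schneider, ibid.), so it is a falsifier of `stub_wildCell`
exactly as of the crux — consistent. Neither stub is equal or trivially equivalent to a refuted
statement (negatives index below): stub 1 is the checked open item stmt-Schanuel-0084 itself; stub 2 is a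
restriction of the checked open item stmt-Schanuel-3765 (refuter-stamped 2026-08-15).

## BC3 audit (this seat; raw outputs under `birth-certificate:` in the seat's NOTES.md)

`lean check --json` rc 0, errors [], `sorry` exactly in `stub_gelfondConjecture`, `stub_wildCell` (sorry
count 2 = stub count, zero elsewhere); `#print axioms DilationRigidity_of` = [propext, Classical.choice,
Quot.sound]. Probes (files `bc/probe_{gelfond,wild}_{crux,summit}.lean` of the seat folder, importing ONLY
the route file — never this file, whose sorried stubs `exact?` would otherwise use — with stub 2 restated
verbatim as `WildCell`, `maxHeartbeats 400000` per example, ONE tactic per example so that a heartbeat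
timeout cannot mask a later alternative of `first | exact? | simpa | aesop`): for
`X ∈ {LogAlphaAlphaBetaAlgIndep, WildCell}` and `T ∈ {DilationRigidity, Schanuel}`, the eight examples
`X → T` by `exact?` · `simpa` · `aesop` · `simpa [X, T]` · `unfold X T; simpa` and `(h : X) : T` by
`simpa using h` · `exact?` · `aesop` — 32/32 FAIL (rc 1 each file; `aesop`: "failed to prove the goal after
exhaustive search" / "made no progress"; `simpa`: "assumption failed" / "type mismatch"; `exact?`: "could
not close the goal" on `WildCell → DilationRigidity`, deterministic `whnf` time-out at the BC budget on the
others and still at 10× budget, `bc/probe_extra_info.lean`, where also `exact?`/`aesop` AFTER introducing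
the binders of `T` fail 6/6). Converses (info, `bc/probe_converse_info.lean`): `DilationRigidity → WildCell`
closes by restriction (exactness, = `wildCell_of_dilationRigidity`); `DilationRigidity →
LogAlphaAlphaBetaAlgIndep`, `Schanuel → WildCell`, `Schanuel → LogAlphaAlphaBetaAlgIndep` do not close
cheaply (true, but one real lemma away: Hermite–Lindemann resp. Schanuel at `n = 2` plus scale-invariance).
No stub is cheaply the crux or the summit: stub 1 knows no wild `y`, stub 2 knows no logarithm.
`ledger negatives --problem Schanuel` (2026-08-17): 2 refuted statements, both the PolarPhantoms
`trdeg < n` target/crux (stmt-Schanuel-6844/6846) — unrelated to either stub.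

## References

* A. O. Gel'fond, *Sur le septième problème de Hilbert*, Izv. Akad. Nauk SSSR 7 (1934) 623–634. [Gelfond1934]
* M. Waldschmidt, *Open Diophantine problems*, Moscow Math. J. 4 (2004), §3.1, arXiv:math/0312440. [Waldschmidt2004]
* Yu. V. Nesterenko, P. Philippon (eds.), *Introduction to algebraic independence theory*, LNM 1752 (2001),
  Ch. 3 Thm 1.1 / Cor. 1.2; Ch. 14 Thm 2.9. [NesterenkoPhilippon2001]
* S. Fischler, T. Rivoal, arXiv:2503.20345 (2025), Thm 1.7 / §4. [FischlerRivoal2025]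
* G. V. Chudnovsky, *Contributions to the theory of transcendental numbers*, AMS Surveys 19 (1984). [Chudnovsky1984]
-/

set_option linter.dupNamespace false
set_option linter.unusedVariables false

noncomputable section

namespace Summit.Schanuel.Schanuel.Cruxes.DilationRigidity.Birth

open Summit.Schanuel.Schanuel.Theses.CoprimeExpPolynomials
open Literature.Barriers.KontsevichZagierPeriods (algebraicIndependent_pair_mul_iff)

/-! ## Signatures of the stubs, as propositions (for the composition and the probes) -/

/-- **Signature of stub 2 (the wild cell)**: the crux restricted to `y, e^y, e^{βy}` all transcendental. -/
def Sig.stub_wildCell : Prop :=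
  ∀ (y β : ℂ), Transcendental ℚ y → Transcendental ℚ (Complex.exp y) →
    Transcendental ℚ (Complex.exp (β * y)) → ¬ AlgebraicIndependent ℚ ![y, Complex.exp y] →
    IsAlgebraic ℚ β → β ∉ Set.range ((↑) : ℚ → ℂ) →
    AlgebraicIndependent ℚ ![β * y, Complex.exp (β * y)]

/-! ## The two registered stubs (the only `sorry`s of this file) -/

/-- **Stub 1 — Gel'fond's conjecture (the log cell and, through `β ↦ β⁻¹`, the inverse log cell).**
Stated BY NAME as the route item it is (`LogAlphaAlphaBetaAlgIndep`, stmt-Schanuel-0084, rank 5, shared with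
route AlgIndepMethod): for algebraic `α = e^l`, `l ≠ 0`, and algebraic irrational `β`, the numbers `l` and
`e^{βl} = α^β` are algebraically independent over `ℚ`. Open (Gelfond1934; Waldschmidt2004 §3.1: open even for
`(log 2, 2^√2)`); proved only for `α` a root of unity and `β` imaginary quadratic (Nesterenko 1996). -/
theorem stub_gelfondConjecture :
    Summit.Schanuel.Schanuel.Theses.CoprimeExpPolynomials.LogAlphaAlphaBetaAlgIndep := by
  sorry

/-- **Stub 2 — the wild cell.** For `y` with `y`, `e^y`, `e^{βy}` all transcendental and `(y, e^y)`
algebraically dependent, and `β` algebraic irrational, `(βy, e^{βy})` is algebraically independent. Open; no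
classical name and no proved instance (it contains the fixed points of `exp` dilated by `√2` or by `i`). -/
theorem stub_wildCell :
    ∀ (y β : ℂ), Transcendental ℚ y → Transcendental ℚ (Complex.exp y) →
      Transcendental ℚ (Complex.exp (β * y)) → ¬ AlgebraicIndependent ℚ ![y, Complex.exp y] →
      IsAlgebraic ℚ β → β ∉ Set.range ((↑) : ℚ → ℂ) →
      AlgebraicIndependent ℚ ![β * y, Complex.exp (β * y)] := by
  sorry

/-! ## Sorry-free lemmas of the seam -/

/-- An irrational complex number is non-zero. [folklore] -/
theorem ne_zero_of_not_mem_range {β : ℂ} (h : β ∉ Set.range ((↑) : ℚ → ℂ)) : β ≠ 0 := by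
  rintro rfl
  exact h ⟨0, by simp⟩

/-- The inverse of an irrational complex number is irrational. [folklore] -/
theorem inv_not_mem_range {β : ℂ} (h : β ∉ Set.range ((↑) : ℚ → ℂ)) :
    β⁻¹ ∉ Set.range ((↑) : ℚ → ℂ) := by
  rintro ⟨q, hq⟩
  refine h ⟨q⁻¹, ?_⟩
  rw [Rat.cast_inv, hq, inv_inv]

/-- A transcendental number is non-zero. [folklore] -/
theorem ne_zero_of_transcendental {y : ℂ} (hy : Transcendental ℚ y) : y ≠ 0 := by
  rintro rfl
  exact hy isAlgebraic_zero

/-- **The fold (sorry-free).** Gel'fond's conjecture alone gives: for `y ∈ 𝒮 ∖ ℚ̄` and `β ∈ ℚ̄ ∖ ℚ`, the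
dilated exponential `e^{βy}` is transcendental. Proof: were `γ := e^{βy}` algebraic, Gel'fond's conjecture at
`(γ, β⁻¹, βy)` makes `![βy, e^{β⁻¹βy}] = ![βy, e^y]` independent, hence `![y, e^y]` (scale-invariance,
`β ∈ ℚ̄ˣ`) — contradicting `y ∈ 𝒮`. [folklore] -/
theorem transcendental_exp_dilate_of_gelfond
    (hG : Summit.Schanuel.Schanuel.Theses.CoprimeExpPolynomials.LogAlphaAlphaBetaAlgIndep)
    {y β : ℂ} (hy : Transcendental ℚ y) (hdep : ¬ AlgebraicIndependent ℚ ![y, Complex.exp y])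
    (hβ : IsAlgebraic ℚ β) (hirr : β ∉ Set.range ((↑) : ℚ → ℂ)) :
    Transcendental ℚ (Complex.exp (β * y)) := by
  intro halg
  have hβ0 : β ≠ 0 := ne_zero_of_not_mem_range hirr
  have hy0 : y ≠ 0 := ne_zero_of_transcendental hy
  have h := hG (Complex.exp (β * y)) β⁻¹ (β * y) halg hβ.inv (inv_not_mem_range hirr) rfl
    (mul_ne_zero hβ0 hy0)
  rw [inv_mul_cancel_left₀ hβ0] at h
  exact hdep ((algebraicIndependent_pair_mul_iff hβ hβ0 y (Complex.exp y)).1 h)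

/-- **The log cell in dilation coordinates (sorry-free from stub 1's statement).** If `e^y` is algebraic
(`y = log α`, `y` transcendental) then `(βy, e^{βy})` is algebraically independent: Gel'fond's conjecture
gives `![y, e^{βy}]`, and scale-invariance moves `y` to `βy`. [folklore] -/
theorem logCell_of_gelfond
    (hG : Summit.Schanuel.Schanuel.Theses.CoprimeExpPolynomials.LogAlphaAlphaBetaAlgIndep)
    {y β : ℂ} (hy : Transcendental ℚ y) (halg : IsAlgebraic ℚ (Complex.exp y))
    (hβ : IsAlgebraic ℚ β) (hirr : β ∉ Set.range ((↑) : ℚ → ℂ)) :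
    AlgebraicIndependent ℚ ![β * y, Complex.exp (β * y)] := by
  have hβ0 : β ≠ 0 := ne_zero_of_not_mem_range hirr
  have h := hG (Complex.exp y) β y halg hβ hirr rfl (ne_zero_of_transcendental hy)
  exact (algebraicIndependent_pair_mul_iff hβ hβ0 y (Complex.exp (β * y))).2 h

/-! ## The composition: the two stubs prove the crux -/

/-- **Composition** (`stub₁ → stub₂ → crux`, sorry-free): split on `IsAlgebraic ℚ (e^y)`; the log cell is
`logCell_of_gelfond`; otherwise `e^y` is transcendental by assumption and `e^{βy}` by the fold
`transcendental_exp_dilate_of_gelfond`, so the wild-cell stub applies. [folklore] -/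
theorem DilationRigidity_of :
    Summit.Schanuel.Schanuel.Theses.CoprimeExpPolynomials.LogAlphaAlphaBetaAlgIndep →
      Sig.stub_wildCell →
        Summit.Schanuel.Schanuel.Theses.CoprimeExpPolynomials.DilationRigidity := by
  intro hG hW y β hy hdep hβ hirr
  by_cases h₁ : IsAlgebraic ℚ (Complex.exp y)
  · exact logCell_of_gelfond hG hy h₁ hβ hirr
  · exact hW y β hy h₁ (transcendental_exp_dilate_of_gelfond hG hy hdep hβ hirr) hdep hβ hirr

/-- **THE SKELETON THEOREM.** The crux `…CoprimeExpPolynomials.DilationRigidity`, concluded BY NAME from the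
two DECLARED stubs `stub_gelfondConjecture` and `stub_wildCell` (the only `sorry`s of the file) through the
sorry-free composition `DilationRigidity_of`. [folklore] -/
theorem DilationRigidity_proof :
    Summit.Schanuel.Schanuel.Theses.CoprimeExpPolynomials.DilationRigidity :=
  DilationRigidity_of stub_gelfondConjecture stub_wildCell

/-! ## Exactness of the cut on the wild side (sorry-free): the crux gives stub 2 back by restriction -/

/-- `DilationRigidity → WildCell` (drop the two extra transcendence hypotheses). The other half of
exactness, `DilationRigidity → LogAlphaAlphaBetaAlgIndep`, is the route's support item `LogCellOfDilation`
(stmt-Schanuel-3772: Hermite–Lindemann makes `l` transcendental, `e^l = α` makes `(l, e^l)` dependent, and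
scale-invariance moves `βl` back to `l`) — not proved here. [folklore] -/
theorem wildCell_of_dilationRigidity
    (h : Summit.Schanuel.Schanuel.Theses.CoprimeExpPolynomials.DilationRigidity) :
    Sig.stub_wildCell := by
  intro y β hy _ _ hdep hβ hirr
  exact h y β hy hdep hβ hirr

/-! ## Calibration (BC5, sorry-free): the CM dilate `(y, β) = (πi, −i)` — Nesterenko 1996 -/

/-- `(−i)·(π i) = π`. [folklore] -/
theorem negI_mul_piI : (-Complex.I) * ((Real.pi : ℂ) * Complex.I) = (Real.pi : ℂ) := by
  linear_combination (-(Real.pi : ℂ)) * Complex.I_mul_I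

/-- **The crux's conclusion at the CM dilate `(y, β) = (πi, −i)`**: `![(−i)(πi), e^{(−i)(πi)}] = ![π, e^π]`
is algebraically independent over `ℚ` — Nesterenko's theorem, PROVED in the tree
(`Literature.Barriers.Schanuel.algebraicIndependent_pi_cexp_pi`, from `nesterenko_holds`).
[cite: NesterenkoPhilippon2001, Ch. 3 Theorem 1.1 and Corollary 1.2 (p. 27)] -/
theorem cmDilate_conclusion :
    AlgebraicIndependent ℚ
      ![(-Complex.I) * ((Real.pi : ℂ) * Complex.I),
        Complex.exp ((-Complex.I) * ((Real.pi : ℂ) * Complex.I))] := by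
  rw [negI_mul_piI]
  exact Literature.Barriers.Schanuel.algebraicIndependent_pi_cexp_pi

/-- `i` is algebraic over `ℚ`. [folklore] -/
theorem isAlgebraic_I : IsAlgebraic ℚ Complex.I :=
  Complex.isIntegral_rat_I.isAlgebraic

/-- `π` (as a complex number) is transcendental — read off Nesterenko's pair. [folklore] -/
theorem transcendental_pi : Transcendental ℚ (Real.pi : ℂ) := by
  simpa using Literature.Barriers.Schanuel.algebraicIndependent_pi_cexp_pi.transcendental 0

/-- **The crux's four hypotheses hold at `(y, β) = (πi, −i)`**: `πi` is transcendental, `(πi, e^{πi})` is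
algebraically dependent (`e^{πi} = −1`), `−i` is algebraic and irrational. So `cmDilate_conclusion` is a
genuine instance of the crux (its log cell), not a vacuous one. [folklore] -/
theorem cmDilate_hypotheses :
    Transcendental ℚ ((Real.pi : ℂ) * Complex.I) ∧
      ¬ AlgebraicIndependent ℚ ![(Real.pi : ℂ) * Complex.I, Complex.exp ((Real.pi : ℂ) * Complex.I)] ∧
      IsAlgebraic ℚ (-Complex.I) ∧ (-Complex.I) ∉ Set.range ((↑) : ℚ → ℂ) := by
  refine ⟨?_, ?_, isAlgebraic_I.neg, ?_⟩
  · -- `πi` algebraic would make `π = (πi)·(−i)` algebraic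
    intro h
    apply transcendental_pi
    have h' : IsAlgebraic ℚ ((Real.pi : ℂ) * Complex.I * (-Complex.I)) := h.mul isAlgebraic_I.neg
    have e : (Real.pi : ℂ) * Complex.I * (-Complex.I) = (Real.pi : ℂ) := by
      linear_combination (-(Real.pi : ℂ)) * Complex.I_mul_I
    rwa [e] at h'
  · -- `e^{πi} = −1` is algebraic, so the pair is dependent
    intro h
    have ht : Transcendental ℚ (Complex.exp ((Real.pi : ℂ) * Complex.I)) := by
      simpa using h.transcendental 1
    apply ht
    rw [Complex.exp_pi_mul_I]
    exact isAlgebraic_one.neg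
  · rintro ⟨q, hq⟩
    have him := congrArg Complex.im hq
    simp at him

/-- **Stub 1's matrix at `(α, β, l) = (−1, −i, πi)`** (the same CM dilate read in the log cell):
`![πi, e^{(−i)(πi)}] = ![πi, e^{π}]` is algebraically independent — Nesterenko's pair moved by the algebraic
unit `i` (scale-invariance). Sorry-free: the only proved cell of Gel'fond's conjecture is inhabited in the
typing of `LogAlphaAlphaBetaAlgIndep`. [cite: NesterenkoPhilippon2001, Ch. 3 Theorem 1.1 and Corollary 1.2 (p. 27)] -/
theorem cmDilate_gelfond_instance :
    AlgebraicIndependent ℚ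
      ![(Real.pi : ℂ) * Complex.I, Complex.exp ((-Complex.I) * ((Real.pi : ℂ) * Complex.I))] := by
  rw [negI_mul_piI, mul_comm (Real.pi : ℂ) Complex.I]
  exact (algebraicIndependent_pair_mul_iff isAlgebraic_I Complex.I_ne_zero (Real.pi : ℂ)
    (Complex.exp (Real.pi : ℂ))).2 Literature.Barriers.Schanuel.algebraicIndependent_pi_cexp_pi

end Summit.Schanuel.Schanuel.Cruxes.DilationRigidity.Birth

end
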